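import Literature.MathematicalPhysics.QuantumFieldTheory.BalabanImbrieJaffe1984to88.BIJ88Eq596Exists
import Literature.MathematicalPhysics.QuantumFieldTheory.BalabanImbrieJaffe1984to88.BIJ88Eq596Frame
import Literature.MathematicalPhysics.QuantumFieldTheory.BalabanImbrieJaffe1984to88.BIJ88GaugeAverage

/-!
# `BalabanImbrieJaffe1984to88.BIJ88Eq596Density` — T. Bałaban, J. Imbrie, A. Jaffe, *Effective action and cluster properties of the
abelian Higgs model*, Commun. Math. Phys. **114** (1988) 257–315 [BalabanImbrieJaffe1988], **(5.9.6)** p. 297 [PDF 41] and p. 282 [PDF 26]: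
*"We have not yet integrated over ψ, so a different density is obtained by replacing ψ′ with ψ. However, the new density ρ^L_{k+1}(v, ψ) still
has the property that ∫dvdψ ρ^L_{k+1}(v, ψ) = [F]."* — **THE RENAMED DENSITY `ρ^L_{k+1}` AND THE RENAMED BRACKET OF (5.9.6) AS OBJECTS.**
This seat's `BIJ88Eq596Frame.eq596_frame` takes the renamed density as ANY solution `ρ₂` of line 1 of (5.9.6) with a renamed bracket `J₂`
(hypotheses `h₂`, `h54`; `eq596_unique` also its integrability `hi₂`).  Here (§1) `ρ^L_{k+1} := rho596 terms Λ J₂ := BIJ88Eq596Exists.rdt (𝒟u δ_{Ax})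
terms Λ J₂` (this seat's Radon–Nikodym construction) discharges `h₂`/`hi₂` from the integrability `hJ₂` of `J₂` in the untranslated variable:
`isDT_rho596`, `integrable_rho596`, **`eq596_frame_rdt`**, `eq596_unique_rdt` (every integrable solution of (5.9.6) is `rho596 terms Λ J₂` a.e.);
(§1b) `renamedBracket Qφ a ρ Λ lamφ lamψ` := the (5.2.8) bracket after (5.3.6) as a function of the rotated fields (`λ⁻¹φ′`, `λ′⁻¹ψ′` substituted)
discharges `h54` (`renamedBracket_twist`): **`eq596_frame_renamed`**; (§1c) `hJ₂` itself is DERIVED from the integrability of the (5.2.8) bracket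
and the measurability of the p. 282 phases (`integrable_renamedBracket`: the rotation is a fibrewise measure-preserving bijection of
`ν ⊗ Π𝒟u^{(j)} ⊗ 𝒟φ ⊗ dψ`): `eq596_frame_renamed'`, **`eq596_printed`** = (5.9.6) with the transcribed bracket `bracket596 D` of `BIJ88Eq596Frame`,
everything constructible constructed — the hypotheses left are the display (5.2.8) with integrable brackets, measurable phases, the p. 284
δ-claims `hs`/`hsupp`/`hQS`, the (5.8.1) shifts `c`, and the ONE pointwise identity `h59` rewriting the renamed bracket into the printed lines 2–8
(the concluding formulae of Sects. 5.4–5.9 — E-level content of rows C2.Eq5.4.x–5.8.x).  (§2) the INSERTION SENTENCES of Sect. 5.9, p. 297 —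
*"The bounds (5.9.4), (5.9.5) allow us to insert the characteristic functions χ_{Λ^{(k)}} = Π_{b∈Λ₁^{(k)*}} χ(cp(e_k), A^{(k)}) Π_{x∈Λ₇^{(k)*}}
χ(cp(e_k), φ^{(k)}) without changing anything"*, *"Thus we can replace χ_{k,Λ₀^{(k−1)′}} with χ_{k,Λ₀^{(k−1)′}∩Λ₁^{(k)c}} without changing
anything"* (and after (5.9.3) *"and the integral is unchanged"*) — AT MEASURE LEVEL: `isDT_insert`, `isDT_replace`, `isDT_bracket596_chars`; the
pointwise agreement they assume is the content of the bounds (5.9.3)–(5.9.5) (rows C2.Eq5.9.3, C2.Eq5.9.4-5.9.5: p02/p36/r16 theorems).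
Seat p34 gen 9, file 7 (own lineage = the C1/C2 renormalization-transformation line).

statement-level skeleton of published theorems with citation tags; proofs where landed; nothing here is a claim about the Yang–Mills mass gap

CITATION HEADER (lean-in-tree rule).  Part of the lit-balaban TYPED SKELETON (HOME `run/shared/lean/pub/lit-balaban/`), PHASE-2 proof seat p34
gen 9 (unit `lit-balaban-p34-g9`; TAKING line HOME/STATUS.md 2026-08-21T21:12:57Z).  Rows served: **`C2.Eq5.9.6`** of `HOME/lit-balaban-r16/ROWS-C2-part2.md`
(owner r16; members: the density of the display exists, is determined by it, and satisfies it with everything constructible constructed); support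
`C2.Eq5.4.1-5.4.6` (the p. 282 sentences), `C2.Eq5.9.3` / `C2.Eq5.9.4-5.9.5` (the insertion sentences, measure level).
PDF held: `paper:balaban1988-cmp114-bij-abelian-higgs-effective-action` (journal page = PDF page + 256); pp. 282, 297 read this session.
WHAT IS PROVED: two defs with bodies (`rho596`, `renamedBracket`; one private plumbing def) + theorems; 0 `sorry`; no `Prop`-valued fact;
standard axioms.  HONEST SCOPE: `h59`, `hs`, `hsupp`, `hQS` stay hypotheses (other rows' content); no bound; nothing of Sects. 5.10–5.15.
Imports this seat's `BIJ88Eq596Exists`, `BIJ88Eq596Frame` and r18's `BIJ88GaugeAverage` (measurable structure on gauge transformations).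
-/

namespace Literature.MathematicalPhysics.QuantumFieldTheory.BalabanImbrieJaffe1984to88.BIJ88Eq596Density

open Literature.MathematicalPhysics.QuantumFieldTheory.Balaban1983to89
open BIJ88Sect3Statements (U1 toC)
open BIJ85Sect1Model (HiggsField)
open BIJ85RT33 (twist measurable_toC measurePreserving_twist)
open BIJ88BlockGauge417 (twist_inv_twist)
open BIJ88RenormTransf311 (axialMeasure axialBonds gaussWeight)
open BIJ88InductiveForm41 (Prev)
open BIJ85BlockAveragesTorus (qU surfMul)
open BIJ88Eq536Linearization (cutoff)
open BIJ88RT52Restrictions (Fields fieldsMeasure IsRD)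
open BIJ88Eq596Display (uCut IsDT translCut_uCut_qU)
open BIJ88InductiveForm41 (prevMeasure)
open BIJ88Eq596Exists (rdt isDT_rdt_axial integrable_rdt)
open BIJ88RT552Transl (bondMul)
open BIJ88Eq596Frame (eq596_frame eq596_unique Entry Bracket596 exponent596 bracket596)
open scoped BigOperators ENNReal
open _root_.MeasureTheory _root_.MeasureTheory.Measure Complex Function

noncomputable section

variable {P : Params} {k : ℕ}

/-! ## §1 The renamed density `ρ^L_{k+1} := rdt (𝒟u δ_{Ax}) terms Λ J₂` -/

section Renamed

variable {ι : Type*} {terms : Finset ι} {Λ : ι → Finset (PBond P (k+1))}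
variable {Qφ : ι → Prev P k → GaugeField P k U1 → HiggsField P k → HiggsField P (k+1)} {a : ℝ}
variable {ρ : ι → Prev P k → GaugeField P k U1 → HiggsField P k → HiggsField P (k+1) → ℂ}
variable {ρL : GaugeField P (k+1) U1 → HiggsField P (k+1) → ℂ}
variable {J₂ : ι → Prev P k → GaugeField P k U1 → GaugeField P (k+1) U1 → HiggsField P k → HiggsField P (k+1) → ℂ}

/-- **`ρ^L_{k+1}` OF (5.9.6): THE RENAMED DENSITY AS AN OBJECT** — *"We have not yet integrated over ψ, so a different density is obtained by replacing
ψ′ with ψ"* (p. 282): the density of the renamed bracket `J₂` over `∫𝒟u δ_{Ax}(u)(·)`, constructed by this seat's Radon–Nikodym engine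
`BIJ88Eq596Exists.rdt` (unique a.e. among integrable solutions: `eq596_unique_rdt`). [cite: BalabanImbrieJaffe1988, (5.9.6) p.297] -/
def rho596 (terms : Finset ι) (Λ : ι → Finset (PBond P (k+1)))
    (J₂ : ι → Prev P k → GaugeField P k U1 → GaugeField P (k+1) U1 → HiggsField P k → HiggsField P (k+1) → ℂ) :
    GaugeField P (k+1) U1 → HiggsField P (k+1) → ℂ :=
  rdt (axialMeasure P k U1) terms Λ J₂

/-- **The renamed density satisfies LINE 1 OF (5.9.6) with the renamed bracket `J₂`** (bracket integrable in the untranslated variable; standing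
range) — the hypothesis `h₂` of `eq596_frame`, discharged. [cite: BalabanImbrieJaffe1988, (5.9.6) p.297] -/
theorem isDT_rho596 (hk : k + 1 ≤ P.m + P.K)
    (hJ₂ : ∀ t ∈ terms, Integrable
      (fun q : Fields P k => J₂ t q.2.1 (uCut qU (Λ t) q.1) (qU q.1) q.2.2.1 q.2.2.2) (fieldsMeasure (axialMeasure P k U1))) :
    IsDT (axialMeasure P k U1) terms Λ qU J₂ (rho596 terms Λ J₂) :=
  isDT_rdt_axial hk hJ₂

/-- **The renamed density is `dv dψ`-integrable** — the hypothesis `hi₂` of `eq596_unique`, discharged. [cite: BalabanImbrieJaffe1988, (5.9.6) p.297] -/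
theorem integrable_rho596
    (hJ₂ : ∀ t ∈ terms, Integrable
      (fun q : Fields P k => J₂ t q.2.1 (uCut qU (Λ t) q.1) (qU q.1) q.2.2.1 q.2.2.2) (fieldsMeasure (axialMeasure P k U1))) :
    Integrable (uncurry (rho596 terms Λ J₂)) ((fieldMeasure P (k+1) U1).prod volume) :=
  integrable_rdt hJ₂

/-- **(5.9.6) AT MEASURE LEVEL FOR THE CONSTRUCTED `ρ^L_{k+1}`** — `eq596_frame` with `ρ₂ := rho596 terms Λ J₂`: from the display (5.2.8), the
rotation identity `h54`, the INTEGRABILITY `hJ₂` of the renamed bracket, the p. 284 δ-claims `hs`/`hsupp`/`hQS` and the pointwise rewriting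
`h59` into the printed bracket: `IsDT (𝒟u δ_{Ax}) terms Λ Q J596 ρ^L_{k+1}` and `∫dvdψ ρ^L_{k+1} = ∫dvdψ ρ̃^L_{k+1}` (standing range).
[cite: BalabanImbrieJaffe1988, (5.9.6) p.297] -/
theorem eq596_frame_rdt (hk : k + 1 ≤ P.m + P.K) (h528 : IsRD (axialMeasure P k U1) terms qU Qφ a ρ ρL)
    (hρi : ∀ t ∈ terms, Integrable
      (fun q : Fields P k => ρ t q.2.1 q.1 q.2.2.1 q.2.2.2 * (gaussWeight a (Qφ t q.2.1 q.1 q.2.2.1) q.2.2.2 : ℂ))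
      (fieldsMeasure (axialMeasure P k U1)))
    (Λ : ι → Finset (PBond P (k+1)))
    (lamφ : ι → Prev P k → GaugeField P k U1 → GaugeField P (k+1) U1 → GaugeTransf P k U1)
    (lamψ : ι → Prev P k → GaugeField P k U1 → GaugeField P (k+1) U1 → GaugeTransf P (k+1) U1)
    (J₂ : ι → Prev P k → GaugeField P k U1 → GaugeField P (k+1) U1 → HiggsField P k → HiggsField P (k+1) → ℂ)
    (h54 : ∀ t ∈ terms, ∀ prev u' v φ ψ,
      ρ t prev (surfMul u' (cutoff (Λ t) v)) φ ψ * (gaussWeight a (Qφ t prev (surfMul u' (cutoff (Λ t) v)) φ) ψ : ℂ) =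
        J₂ t prev u' v (twist (lamφ t prev u' v) φ) (twist (lamψ t prev u' v) ψ))
    (hJ₂ : ∀ t ∈ terms, Integrable
      (fun q : Fields P k => J₂ t q.2.1 (uCut qU (Λ t) q.1) (qU q.1) q.2.2.1 q.2.2.2) (fieldsMeasure (axialMeasure P k U1)))
    (s : ι → GaugeField P (k+1) U1 → GaugeField P k U1) (hs : ∀ t ∈ terms, ∀ w, ∀ b ∈ (axialBonds : Finset (PBond P k)), s t w b = 1)
    (S : ι → Set (GaugeField P k U1)) (hsupp : ∀ t ∈ terms, ∀ prev u' v φ ψ, J₂ t prev u' v φ ψ ≠ 0 → u' ∈ S t)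
    (hQS : ∀ t ∈ terms, ∀ u' ∈ S t, ∀ w, qU (bondMul u' (s t w)) = qU u' ∧ qU (bondMul u' fun b => (s t w b)⁻¹) = qU u')
    (c : ι → Prev P k → GaugeField P k U1 → GaugeField P (k+1) U1 → HiggsField P (k+1) → HiggsField P k)
    (J596 : ι → Prev P k → GaugeField P k U1 → GaugeField P (k+1) U1 → HiggsField P k → HiggsField P (k+1) → ℂ)
    (h59 : ∀ t ∈ terms, ∀ prev u' v φ ψ,
      J596 t prev u' v φ ψ = J₂ t prev (bondMul u' (s t (cutoff (Λ t) v))) v (φ + c t prev u' v ψ) ψ) :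
    IsDT (axialMeasure P k U1) terms Λ qU J596 (rho596 terms Λ J₂) ∧
      ∫ v, ∫ ψ, rho596 terms Λ J₂ v ψ ∂volume ∂fieldMeasure P (k+1) U1 = ∫ v, ∫ ψ, ρL v ψ ∂volume ∂fieldMeasure P (k+1) U1 :=
  eq596_frame hk h528 hρi Λ lamφ lamψ J₂ h54 (isDT_rho596 hk hJ₂) s hs S hsupp hQS c J596 h59

/-- **(5.9.6) determines `ρ^L_{k+1}`** — `eq596_unique` for the constructed density: every `dv dψ`-integrable solution of line 1 of (5.9.6) with the
printed bracket equals `rho596 terms Λ J₂` almost everywhere. [cite: BalabanImbrieJaffe1988, (5.9.6) p.297] -/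
theorem eq596_unique_rdt (hk : k + 1 ≤ P.m + P.K) (h528 : IsRD (axialMeasure P k U1) terms qU Qφ a ρ ρL)
    (hρi : ∀ t ∈ terms, Integrable
      (fun q : Fields P k => ρ t q.2.1 q.1 q.2.2.1 q.2.2.2 * (gaussWeight a (Qφ t q.2.1 q.1 q.2.2.1) q.2.2.2 : ℂ))
      (fieldsMeasure (axialMeasure P k U1)))
    (Λ : ι → Finset (PBond P (k+1)))
    (lamφ : ι → Prev P k → GaugeField P k U1 → GaugeField P (k+1) U1 → GaugeTransf P k U1)
    (lamψ : ι → Prev P k → GaugeField P k U1 → GaugeField P (k+1) U1 → GaugeTransf P (k+1) U1)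
    (J₂ : ι → Prev P k → GaugeField P k U1 → GaugeField P (k+1) U1 → HiggsField P k → HiggsField P (k+1) → ℂ)
    (h54 : ∀ t ∈ terms, ∀ prev u' v φ ψ,
      ρ t prev (surfMul u' (cutoff (Λ t) v)) φ ψ * (gaussWeight a (Qφ t prev (surfMul u' (cutoff (Λ t) v)) φ) ψ : ℂ) =
        J₂ t prev u' v (twist (lamφ t prev u' v) φ) (twist (lamψ t prev u' v) ψ))
    (hJ₂ : ∀ t ∈ terms, Integrable
      (fun q : Fields P k => J₂ t q.2.1 (uCut qU (Λ t) q.1) (qU q.1) q.2.2.1 q.2.2.2) (fieldsMeasure (axialMeasure P k U1)))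
    (s : ι → GaugeField P (k+1) U1 → GaugeField P k U1) (hs : ∀ t ∈ terms, ∀ w, ∀ b ∈ (axialBonds : Finset (PBond P k)), s t w b = 1)
    (S : ι → Set (GaugeField P k U1)) (hsupp : ∀ t ∈ terms, ∀ prev u' v φ ψ, J₂ t prev u' v φ ψ ≠ 0 → u' ∈ S t)
    (hQS : ∀ t ∈ terms, ∀ u' ∈ S t, ∀ w, qU (bondMul u' (s t w)) = qU u' ∧ qU (bondMul u' fun b => (s t w b)⁻¹) = qU u')
    (c : ι → Prev P k → GaugeField P k U1 → GaugeField P (k+1) U1 → HiggsField P (k+1) → HiggsField P k)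
    (J596 : ι → Prev P k → GaugeField P k U1 → GaugeField P (k+1) U1 → HiggsField P k → HiggsField P (k+1) → ℂ)
    (h59 : ∀ t ∈ terms, ∀ prev u' v φ ψ,
      J596 t prev u' v φ ψ = J₂ t prev (bondMul u' (s t (cutoff (Λ t) v))) v (φ + c t prev u' v ψ) ψ)
    {ρ' : GaugeField P (k+1) U1 → HiggsField P (k+1) → ℂ} (hi' : Integrable (uncurry ρ') ((fieldMeasure P (k+1) U1).prod volume))
    (h' : IsDT (axialMeasure P k U1) terms Λ qU J596 ρ') :
    uncurry ρ' =ᵐ[(fieldMeasure P (k+1) U1).prod volume] uncurry (rho596 terms Λ J₂) :=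
  eq596_unique hk h528 hρi Λ lamφ lamψ J₂ h54 (isDT_rho596 hk hJ₂) (integrable_rho596 hJ₂) s hs S hsupp hQS c J596 h59 hi' h'

/-- **THE RENAMED BRACKET `J₂`, DEFINED** — p. 282: *"we obtain new fields φ′, ψ′ … The measure dφ is rotationally invariant, so we can replace dφ
with dφ′ and drop the prime … a different density is obtained by replacing ψ′ with ψ"*: the (5.2.8) bracket `ρ_t·exp-Gaussian`, read after the
translation (5.3.6) at `u = u′·cutoff_{Λ_t}(v)`, AS A FUNCTION OF THE ROTATED FIELDS — `J₂(t, {u^{(j)}}, u′, v, φ′, ψ′) := (ρ_t·gaussWeight)(…,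
λ⁻¹φ′, λ′⁻¹ψ′)` with the p. 282 phases `λ = lamφ`, `λ′ = lamψ` (functions of `({u^{(j)}}, u′, v)`).  With this definition the hypothesis `h54` of
`BIJ88Eq596Frame.eq596_frame` holds identically (`renamedBracket_twist`). [cite: BalabanImbrieJaffe1988, (5.4.5)–(5.4.6) p.282] -/
def renamedBracket (Qφ : ι → Prev P k → GaugeField P k U1 → HiggsField P k → HiggsField P (k+1)) (a : ℝ)
    (ρ : ι → Prev P k → GaugeField P k U1 → HiggsField P k → HiggsField P (k+1) → ℂ) (Λ : ι → Finset (PBond P (k+1)))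
    (lamφ : ι → Prev P k → GaugeField P k U1 → GaugeField P (k+1) U1 → GaugeTransf P k U1)
    (lamψ : ι → Prev P k → GaugeField P k U1 → GaugeField P (k+1) U1 → GaugeTransf P (k+1) U1) :
    ι → Prev P k → GaugeField P k U1 → GaugeField P (k+1) U1 → HiggsField P k → HiggsField P (k+1) → ℂ :=
  fun t prev u' v φ' ψ' =>
    ρ t prev (surfMul u' (cutoff (Λ t) v)) (twist (fun x => (lamφ t prev u' v x)⁻¹) φ') (twist (fun y => (lamψ t prev u' v y)⁻¹) ψ') *
      (gaussWeight a (Qφ t prev (surfMul u' (cutoff (Λ t) v)) (twist (fun x => (lamφ t prev u' v x)⁻¹) φ'))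
        (twist (fun y => (lamψ t prev u' v y)⁻¹) ψ') : ℂ)

/-- **`h54` holds for the defined renamed bracket**: `(ρ_t·gaussWeight)(…, u′·cutoff(v), φ, ψ) = J₂(…, u′, v, λφ, λ′ψ)` (r18's `twist_inv_twist`).
[cite: BalabanImbrieJaffe1988, (5.4.5)–(5.4.6) p.282] -/
theorem renamedBracket_twist (Qφ : ι → Prev P k → GaugeField P k U1 → HiggsField P k → HiggsField P (k+1)) (a : ℝ)
    (ρ : ι → Prev P k → GaugeField P k U1 → HiggsField P k → HiggsField P (k+1) → ℂ) (Λ : ι → Finset (PBond P (k+1)))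
    (lamφ : ι → Prev P k → GaugeField P k U1 → GaugeField P (k+1) U1 → GaugeTransf P k U1)
    (lamψ : ι → Prev P k → GaugeField P k U1 → GaugeField P (k+1) U1 → GaugeTransf P (k+1) U1) :
    ∀ t ∈ terms, ∀ prev u' v φ ψ,
      ρ t prev (surfMul u' (cutoff (Λ t) v)) φ ψ * (gaussWeight a (Qφ t prev (surfMul u' (cutoff (Λ t) v)) φ) ψ : ℂ) =
        renamedBracket Qφ a ρ Λ lamφ lamψ t prev u' v (twist (lamφ t prev u' v) φ) (twist (lamψ t prev u' v) ψ) := by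
  intro t _ prev u' v φ ψ
  simp only [renamedBracket, twist_inv_twist]

/-- **(5.9.6) AT MEASURE LEVEL WITH THE RENAMED BRACKET AND THE RENAMED DENSITY BOTH DEFINED** — `eq596_frame` with
`J₂ := renamedBracket Qφ a ρ Λ lamφ lamψ` and `ρ^L_{k+1} := rho596 terms Λ J₂`: the hypotheses `h54` and `h₂` of `BIJ88Eq596Frame.eq596_frame` are
gone; what remains is printed data — the display (5.2.8) `h528` with integrable brackets before (`hρi`) and after (`hJ₂`) the renaming, the p. 284
δ-claims `hs`/`hsupp`/`hQS` for the (5.5.2) shifts, the (5.8.1) shifts `c`, and the pointwise rewriting `h59` of the renamed bracket, read in the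
shifted and translated variables, into the printed bracket `J596` (the concluding formulae of Sects. 5.4–5.9).
[cite: BalabanImbrieJaffe1988, (5.9.6) p.297] -/
theorem eq596_frame_renamed (hk : k + 1 ≤ P.m + P.K) (h528 : IsRD (axialMeasure P k U1) terms qU Qφ a ρ ρL)
    (hρi : ∀ t ∈ terms, Integrable
      (fun q : Fields P k => ρ t q.2.1 q.1 q.2.2.1 q.2.2.2 * (gaussWeight a (Qφ t q.2.1 q.1 q.2.2.1) q.2.2.2 : ℂ))
      (fieldsMeasure (axialMeasure P k U1)))
    (Λ : ι → Finset (PBond P (k+1)))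
    (lamφ : ι → Prev P k → GaugeField P k U1 → GaugeField P (k+1) U1 → GaugeTransf P k U1)
    (lamψ : ι → Prev P k → GaugeField P k U1 → GaugeField P (k+1) U1 → GaugeTransf P (k+1) U1)
    (hJ₂ : ∀ t ∈ terms, Integrable
      (fun q : Fields P k => renamedBracket Qφ a ρ Λ lamφ lamψ t q.2.1 (uCut qU (Λ t) q.1) (qU q.1) q.2.2.1 q.2.2.2)
      (fieldsMeasure (axialMeasure P k U1)))
    (s : ι → GaugeField P (k+1) U1 → GaugeField P k U1) (hs : ∀ t ∈ terms, ∀ w, ∀ b ∈ (axialBonds : Finset (PBond P k)), s t w b = 1)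
    (S : ι → Set (GaugeField P k U1))
    (hsupp : ∀ t ∈ terms, ∀ prev u' v φ ψ, renamedBracket Qφ a ρ Λ lamφ lamψ t prev u' v φ ψ ≠ 0 → u' ∈ S t)
    (hQS : ∀ t ∈ terms, ∀ u' ∈ S t, ∀ w, qU (bondMul u' (s t w)) = qU u' ∧ qU (bondMul u' fun b => (s t w b)⁻¹) = qU u')
    (c : ι → Prev P k → GaugeField P k U1 → GaugeField P (k+1) U1 → HiggsField P (k+1) → HiggsField P k)
    (J596 : ι → Prev P k → GaugeField P k U1 → GaugeField P (k+1) U1 → HiggsField P k → HiggsField P (k+1) → ℂ)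
    (h59 : ∀ t ∈ terms, ∀ prev u' v φ ψ, J596 t prev u' v φ ψ =
      renamedBracket Qφ a ρ Λ lamφ lamψ t prev (bondMul u' (s t (cutoff (Λ t) v))) v (φ + c t prev u' v ψ) ψ) :
    IsDT (axialMeasure P k U1) terms Λ qU J596 (rho596 terms Λ (renamedBracket Qφ a ρ Λ lamφ lamψ)) ∧
      ∫ v, ∫ ψ, rho596 terms Λ (renamedBracket Qφ a ρ Λ lamφ lamψ) v ψ ∂volume ∂fieldMeasure P (k+1) U1 =
        ∫ v, ∫ ψ, ρL v ψ ∂volume ∂fieldMeasure P (k+1) U1 :=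
  eq596_frame_rdt hk h528 hρi Λ lamφ lamψ _ (renamedBracket_twist Qφ a ρ Λ lamφ lamψ) hJ₂ s hs S hsupp hQS c J596 h59

variable {ν : Measure (GaugeField P k U1)}

/-- kernel: joint measurability of the site rotation `(g, φ) ↦ gφ` (`U(1)` acts continuously). [cite: BalabanImbrieJaffe1988, (5.4.5) p.282] -/
private theorem measurable_twist₂ {j : ℕ} : Measurable fun p : GaugeTransf P j U1 × HiggsField P j => twist p.1 p.2 := by
  refine measurable_pi_lambda _ fun x => ?_
  have h1 : Measurable fun p : GaugeTransf P j U1 × HiggsField P j => toC (p.1 x) :=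
    measurable_toC.comp ((measurable_pi_apply x).comp measurable_fst)
  have h2 : Measurable fun p : GaugeTransf P j U1 × HiggsField P j => p.2 x := (measurable_pi_apply x).comp measurable_snd
  exact h1.mul h2

/-- kernel: `g ↦ g⁻¹` is measurable on gauge transformations. [cite: BalabanImbrieJaffe1988, (5.4.5) p.282] -/
private theorem measurable_invTransf {j : ℕ} : Measurable fun g : GaugeTransf P j U1 => (fun x => (g x)⁻¹ : GaugeTransf P j U1) :=
  measurable_pi_lambda _ fun x => (measurable_pi_apply x).inv

/-- kernel: the fibrewise rotation `({u^{(j)}}, φ, ψ) ↦ ({u^{(j)}}, g_φ(u,{u^{(j)}})φ, g_ψ(u,{u^{(j)}})ψ)` over a fixed `u`.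
[cite: BalabanImbrieJaffe1988, (5.4.5)–(5.4.6) p.282] -/
private def rotFib (gφ : GaugeField P k U1 → Prev P k → GaugeTransf P k U1) (gψ : GaugeField P k U1 → Prev P k → GaugeTransf P (k+1) U1)
    (U : GaugeField P k U1) (r : Prev P k × (HiggsField P k × HiggsField P (k+1))) : Prev P k × (HiggsField P k × HiggsField P (k+1)) :=
  (r.1, (twist (gφ U r.1) r.2.1, twist (gψ U r.1) r.2.2))

/-- kernel: the fibrewise rotation is jointly measurable. [cite: BalabanImbrieJaffe1988, (5.4.5)–(5.4.6) p.282] -/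
private theorem measurable_rotFib {gφ : GaugeField P k U1 → Prev P k → GaugeTransf P k U1}
    {gψ : GaugeField P k U1 → Prev P k → GaugeTransf P (k+1) U1}
    (hgφ : Measurable fun x : GaugeField P k U1 × Prev P k => gφ x.1 x.2) (hgψ : Measurable fun x : GaugeField P k U1 × Prev P k => gψ x.1 x.2) :
    Measurable (uncurry (rotFib gφ gψ)) := by
  refine measurable_snd.fst.prodMk (Measurable.prodMk ?_ ?_)
  · exact measurable_twist₂.comp ((hgφ.comp (measurable_fst.prodMk measurable_snd.fst)).prodMk measurable_snd.snd.fst)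
  · exact measurable_twist₂.comp ((hgψ.comp (measurable_fst.prodMk measurable_snd.fst)).prodMk measurable_snd.snd.snd)

/-- kernel: over each fixed `u` the fibrewise rotation preserves `Π𝒟u^{(j)} ⊗ 𝒟φ ⊗ dψ` (r18's `measurePreserving_twist`, as a skew product over
`{u^{(j)}}`). [cite: BalabanImbrieJaffe1988, (5.4.5)–(5.4.6) p.282] -/
private theorem measurePreserving_rotFib {gφ : GaugeField P k U1 → Prev P k → GaugeTransf P k U1}
    {gψ : GaugeField P k U1 → Prev P k → GaugeTransf P (k+1) U1}
    (hgφ : Measurable fun x : GaugeField P k U1 × Prev P k => gφ x.1 x.2) (hgψ : Measurable fun x : GaugeField P k U1 × Prev P k => gψ x.1 x.2)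
    (U : GaugeField P k U1) :
    MeasurePreserving (rotFib gφ gψ U)
      ((prevMeasure P k).prod ((volume : Measure (HiggsField P k)).prod (volume : Measure (HiggsField P (k+1)))))
      ((prevMeasure P k).prod ((volume : Measure (HiggsField P k)).prod (volume : Measure (HiggsField P (k+1))))) := by
  have hin : Measurable (uncurry fun (prev : Prev P k) (z : HiggsField P k × HiggsField P (k+1)) =>
      (twist (gφ U prev) z.1, twist (gψ U prev) z.2)) := by
    refine Measurable.prodMk ?_ ?_
    · exact measurable_twist₂.comp ((hgφ.comp (measurable_const.prodMk measurable_fst)).prodMk measurable_snd.fst)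
    · exact measurable_twist₂.comp ((hgψ.comp (measurable_const.prodMk measurable_fst)).prodMk measurable_snd.snd)
  exact (MeasurePreserving.id (prevMeasure P k)).skew_product hin
    (Filter.Eventually.of_forall fun prev => ((measurePreserving_twist (gφ U prev)).prod (measurePreserving_twist (gψ U prev))).map_eq)

/-- kernel: the fibrewise rotation preserves the configuration measure `ν ⊗ Π𝒟u^{(j)} ⊗ 𝒟φ ⊗ dψ` (skew product over `u`).
[cite: BalabanImbrieJaffe1988, (5.4.5)–(5.4.6) p.282] -/
private theorem measurePreserving_fields_rotFib [SFinite ν] {gφ : GaugeField P k U1 → Prev P k → GaugeTransf P k U1}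
    {gψ : GaugeField P k U1 → Prev P k → GaugeTransf P (k+1) U1}
    (hgφ : Measurable fun x : GaugeField P k U1 × Prev P k => gφ x.1 x.2) (hgψ : Measurable fun x : GaugeField P k U1 × Prev P k => gψ x.1 x.2) :
    MeasurePreserving (fun q : Fields P k => (q.1, rotFib gφ gψ q.1 q.2)) (fieldsMeasure ν) (fieldsMeasure ν) := by
  unfold fieldsMeasure
  exact (MeasurePreserving.id ν).skew_product (measurable_rotFib hgφ hgψ)
    (Filter.Eventually.of_forall fun U => (measurePreserving_rotFib hgφ hgψ U).map_eq)

/-- **The renamed bracket is integrable in the untranslated variable whenever the (5.2.8) bracket is** — *"The measure dφ is rotationally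
invariant"* (p. 282) at the level of integrability: the phases `λ`, `λ′` being measurable functions of `({u^{(j)}}, u′, v)` (in print
`e^{ie_k(Λ̄₃^{(k)}C_{k,loc}A′)}`, continuous in `A′`), the substitution `(φ, ψ) ↦ (λ⁻¹φ, λ′⁻¹ψ)` is a fibrewise measure-preserving bijection of
`ν ⊗ Π𝒟u^{(j)} ⊗ 𝒟φ ⊗ dψ`, so the hypothesis `hJ₂` of `eq596_frame_rdt`/`eq596_frame_renamed` follows from `hρi` (and `(u′_Λ(u))·Q^{s*}(cutoff
Q(u)) = u`, this seat's `translCut_uCut_qU`). [cite: BalabanImbrieJaffe1988, (5.4.5)–(5.4.6) p.282] -/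
theorem integrable_renamedBracket [SFinite ν] (Qφ : ι → Prev P k → GaugeField P k U1 → HiggsField P k → HiggsField P (k+1)) (a : ℝ)
    (ρ : ι → Prev P k → GaugeField P k U1 → HiggsField P k → HiggsField P (k+1) → ℂ) (Λ : ι → Finset (PBond P (k+1)))
    (lamφ : ι → Prev P k → GaugeField P k U1 → GaugeField P (k+1) U1 → GaugeTransf P k U1)
    (lamψ : ι → Prev P k → GaugeField P k U1 → GaugeField P (k+1) U1 → GaugeTransf P (k+1) U1) (t : ι)
    (hρi : Integrable
      (fun q : Fields P k => ρ t q.2.1 q.1 q.2.2.1 q.2.2.2 * (gaussWeight a (Qφ t q.2.1 q.1 q.2.2.1) q.2.2.2 : ℂ)) (fieldsMeasure ν))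
    (hmφ : Measurable fun x : GaugeField P k U1 × Prev P k => lamφ t x.2 (uCut qU (Λ t) x.1) (qU x.1))
    (hmψ : Measurable fun x : GaugeField P k U1 × Prev P k => lamψ t x.2 (uCut qU (Λ t) x.1) (qU x.1)) :
    Integrable
      (fun q : Fields P k => renamedBracket Qφ a ρ Λ lamφ lamψ t q.2.1 (uCut qU (Λ t) q.1) (qU q.1) q.2.2.1 q.2.2.2)
      (fieldsMeasure ν) := by
  have hgφ : Measurable fun x : GaugeField P k U1 × Prev P k =>
      (fun y => (lamφ t x.2 (uCut qU (Λ t) x.1) (qU x.1) y)⁻¹ : GaugeTransf P k U1) := measurable_invTransf.comp hmφ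
  have hgψ : Measurable fun x : GaugeField P k U1 × Prev P k =>
      (fun y => (lamψ t x.2 (uCut qU (Λ t) x.1) (qU x.1) y)⁻¹ : GaugeTransf P (k+1) U1) := measurable_invTransf.comp hmψ
  have hΦ := measurePreserving_fields_rotFib (ν := ν)
    (gφ := fun U prev => fun y => (lamφ t prev (uCut qU (Λ t) U) (qU U) y)⁻¹)
    (gψ := fun U prev => fun y => (lamψ t prev (uCut qU (Λ t) U) (qU U) y)⁻¹) hgφ hgψ
  have h := (hΦ.integrable_comp hρi.aestronglyMeasurable).mpr hρi
  refine h.congr (ae_of_all _ fun q => ?_)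
  simp only [Function.comp_apply, rotFib, renamedBracket, translCut_uCut_qU]

/-- **(5.9.6) AT MEASURE LEVEL, `J₂` and `ρ^L_{k+1}` defined, the integrability after renaming DERIVED** — `eq596_frame_renamed` with `hJ₂`
replaced by the measurability of the p. 282 phases. [cite: BalabanImbrieJaffe1988, (5.9.6) p.297] -/
theorem eq596_frame_renamed' (hk : k + 1 ≤ P.m + P.K) (h528 : IsRD (axialMeasure P k U1) terms qU Qφ a ρ ρL)
    (hρi : ∀ t ∈ terms, Integrable
      (fun q : Fields P k => ρ t q.2.1 q.1 q.2.2.1 q.2.2.2 * (gaussWeight a (Qφ t q.2.1 q.1 q.2.2.1) q.2.2.2 : ℂ))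
      (fieldsMeasure (axialMeasure P k U1)))
    (Λ : ι → Finset (PBond P (k+1)))
    (lamφ : ι → Prev P k → GaugeField P k U1 → GaugeField P (k+1) U1 → GaugeTransf P k U1)
    (lamψ : ι → Prev P k → GaugeField P k U1 → GaugeField P (k+1) U1 → GaugeTransf P (k+1) U1)
    (hmφ : ∀ t ∈ terms, Measurable fun x : GaugeField P k U1 × Prev P k => lamφ t x.2 (uCut qU (Λ t) x.1) (qU x.1))
    (hmψ : ∀ t ∈ terms, Measurable fun x : GaugeField P k U1 × Prev P k => lamψ t x.2 (uCut qU (Λ t) x.1) (qU x.1))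
    (s : ι → GaugeField P (k+1) U1 → GaugeField P k U1) (hs : ∀ t ∈ terms, ∀ w, ∀ b ∈ (axialBonds : Finset (PBond P k)), s t w b = 1)
    (S : ι → Set (GaugeField P k U1))
    (hsupp : ∀ t ∈ terms, ∀ prev u' v φ ψ, renamedBracket Qφ a ρ Λ lamφ lamψ t prev u' v φ ψ ≠ 0 → u' ∈ S t)
    (hQS : ∀ t ∈ terms, ∀ u' ∈ S t, ∀ w, qU (bondMul u' (s t w)) = qU u' ∧ qU (bondMul u' fun b => (s t w b)⁻¹) = qU u')
    (c : ι → Prev P k → GaugeField P k U1 → GaugeField P (k+1) U1 → HiggsField P (k+1) → HiggsField P k)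
    (J596 : ι → Prev P k → GaugeField P k U1 → GaugeField P (k+1) U1 → HiggsField P k → HiggsField P (k+1) → ℂ)
    (h59 : ∀ t ∈ terms, ∀ prev u' v φ ψ, J596 t prev u' v φ ψ =
      renamedBracket Qφ a ρ Λ lamφ lamψ t prev (bondMul u' (s t (cutoff (Λ t) v))) v (φ + c t prev u' v ψ) ψ) :
    IsDT (axialMeasure P k U1) terms Λ qU J596 (rho596 terms Λ (renamedBracket Qφ a ρ Λ lamφ lamψ)) ∧
      ∫ v, ∫ ψ, rho596 terms Λ (renamedBracket Qφ a ρ Λ lamφ lamψ) v ψ ∂volume ∂fieldMeasure P (k+1) U1 =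
        ∫ v, ∫ ψ, ρL v ψ ∂volume ∂fieldMeasure P (k+1) U1 :=
  eq596_frame_renamed hk h528 hρi Λ lamφ lamψ
    (fun t ht => integrable_renamedBracket Qφ a ρ Λ lamφ lamψ t (hρi t ht) (hmφ t ht) (hmψ t ht)) s hs S hsupp hQS c J596 h59

/-- **(5.9.6) WITH THE TRANSCRIBED BRACKET, EVERYTHING CONSTRUCTIBLE CONSTRUCTED** — `eq596_frame_renamed'` with `J596 := bracket596 D`: the
renamed bracket `J₂` and the density `ρ^L_{k+1}` are DEFINED, the integrability after renaming is DERIVED; the hypotheses left are the display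
(5.2.8) with integrable brackets, the measurability of the p. 282 phases, the p. 284 δ-claims, the (5.8.1) shifts and the ONE pointwise identity
`h59` rewriting the renamed bracket into the printed lines 2–8 of (5.9.6). [cite: BalabanImbrieJaffe1988, (5.9.6) p.297] -/
theorem eq596_printed (D : Bracket596 P k ι) (hk : k + 1 ≤ P.m + P.K) (h528 : IsRD (axialMeasure P k U1) terms qU Qφ a ρ ρL)
    (hρi : ∀ t ∈ terms, Integrable
      (fun q : Fields P k => ρ t q.2.1 q.1 q.2.2.1 q.2.2.2 * (gaussWeight a (Qφ t q.2.1 q.1 q.2.2.1) q.2.2.2 : ℂ))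
      (fieldsMeasure (axialMeasure P k U1)))
    (Λ : ι → Finset (PBond P (k+1)))
    (lamφ : ι → Prev P k → GaugeField P k U1 → GaugeField P (k+1) U1 → GaugeTransf P k U1)
    (lamψ : ι → Prev P k → GaugeField P k U1 → GaugeField P (k+1) U1 → GaugeTransf P (k+1) U1)
    (hmφ : ∀ t ∈ terms, Measurable fun x : GaugeField P k U1 × Prev P k => lamφ t x.2 (uCut qU (Λ t) x.1) (qU x.1))
    (hmψ : ∀ t ∈ terms, Measurable fun x : GaugeField P k U1 × Prev P k => lamψ t x.2 (uCut qU (Λ t) x.1) (qU x.1))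
    (s : ι → GaugeField P (k+1) U1 → GaugeField P k U1) (hs : ∀ t ∈ terms, ∀ w, ∀ b ∈ (axialBonds : Finset (PBond P k)), s t w b = 1)
    (S : ι → Set (GaugeField P k U1))
    (hsupp : ∀ t ∈ terms, ∀ prev u' v φ ψ, renamedBracket Qφ a ρ Λ lamφ lamψ t prev u' v φ ψ ≠ 0 → u' ∈ S t)
    (hQS : ∀ t ∈ terms, ∀ u' ∈ S t, ∀ w, qU (bondMul u' (s t w)) = qU u' ∧ qU (bondMul u' fun b => (s t w b)⁻¹) = qU u')
    (c : ι → Prev P k → GaugeField P k U1 → GaugeField P (k+1) U1 → HiggsField P (k+1) → HiggsField P k)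
    (h59 : ∀ t ∈ terms, ∀ prev u' v φ ψ, bracket596 D t prev u' v φ ψ =
      renamedBracket Qφ a ρ Λ lamφ lamψ t prev (bondMul u' (s t (cutoff (Λ t) v))) v (φ + c t prev u' v ψ) ψ) :
    IsDT (axialMeasure P k U1) terms Λ qU (bracket596 D) (rho596 terms Λ (renamedBracket Qφ a ρ Λ lamφ lamψ)) ∧
      ∫ v, ∫ ψ, rho596 terms Λ (renamedBracket Qφ a ρ Λ lamφ lamψ) v ψ ∂volume ∂fieldMeasure P (k+1) U1 =
        ∫ v, ∫ ψ, ρL v ψ ∂volume ∂fieldMeasure P (k+1) U1 :=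
  eq596_frame_renamed' hk h528 hρi Λ lamφ lamψ hmφ hmψ s hs S hsupp hQS c (bracket596 D) h59

end Renamed

/-! ## §2 Sect. 5.9: insertions *"without changing anything"* at measure level -/

section Insert

variable {ι : Type*} {ν : Measure (GaugeField P k U1)} {terms : Finset ι} {Λ : ι → Finset (PBond P (k+1))}
variable {Qu : GaugeField P k U1 → GaugeField P (k+1) U1}
variable {J R : ι → Prev P k → GaugeField P k U1 → GaugeField P (k+1) U1 → HiggsField P k → HiggsField P (k+1) → ℂ}
variable {ρL : GaugeField P (k+1) U1 → HiggsField P (k+1) → ℂ}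

/-- **p. 297: *"The bounds (5.9.4), (5.9.5) allow us to insert the characteristic functions χ_{Λ^{(k)}} = Π_{b∈Λ₁^{(k)*}} χ(cp(e_k), A^{(k)})
Π_{x∈Λ₇^{(k)*}} χ(cp(e_k), φ^{(k)}) without changing anything"*** (likewise after (5.9.3): *"and the integral is unchanged"*) — AT MEASURE LEVEL: a
factor `χ_t({u^{(j)}}, u^{(k)}, v, φ^{(k)}, ψ)` equal to `1` wherever the bracket `J_t` does not vanish (this is what the bounds give on the support
of the restrictions already present) may be inserted into the bracket of line 1 of (5.9.6): the same density satisfies the display with `χ·J`.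
[cite: BalabanImbrieJaffe1988, (5.9.4)–(5.9.6) p.297] -/
theorem isDT_insert (χ : ι → Prev P k → GaugeField P k U1 → GaugeField P (k+1) U1 → HiggsField P k → HiggsField P (k+1) → ℂ)
    (hχ : ∀ t ∈ terms, ∀ prev u' v φ ψ, J t prev u' v φ ψ ≠ 0 → χ t prev u' v φ ψ = 1) (h : IsDT ν terms Λ Qu J ρL) :
    IsDT ν terms Λ Qu (fun t prev u' v φ ψ => χ t prev u' v φ ψ * J t prev u' v φ ψ) ρL :=
  h.congr' fun t ht prev u' v φ ψ => by
    by_cases hJ : J t prev u' v φ ψ = 0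
    · rw [hJ, mul_zero]
    · rw [hχ t ht prev u' v φ ψ hJ, one_mul]

/-- **p. 297: *"Thus we can replace χ_{k,Λ₀^{(k−1)′}} with χ_{k,Λ₀^{(k−1)′}∩Λ₁^{(k)c}} without changing anything"*** — AT MEASURE LEVEL: a factor
`χ_t` of the bracket `χ_t·R_t` may be replaced by a factor `χ′_t` that agrees with it wherever the rest `R_t` of the bracket does not vanish (in
print: *"the restrictions implied by χ_{Λ^{(k)}} are stronger than the corresponding restrictions in χ_{k,Λ₀^{(k−1)′}} in Λ₁^{(k)}"*).
[cite: BalabanImbrieJaffe1988, (5.9.5)–(5.9.6) p.297] -/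
theorem isDT_replace (χ χ' : ι → Prev P k → GaugeField P k U1 → GaugeField P (k+1) U1 → HiggsField P k → HiggsField P (k+1) → ℂ)
    (hχ : ∀ t ∈ terms, ∀ prev u' v φ ψ, R t prev u' v φ ψ ≠ 0 → χ' t prev u' v φ ψ = χ t prev u' v φ ψ)
    (h : IsDT ν terms Λ Qu (fun t prev u' v φ ψ => χ t prev u' v φ ψ * R t prev u' v φ ψ) ρL) :
    IsDT ν terms Λ Qu (fun t prev u' v φ ψ => χ' t prev u' v φ ψ * R t prev u' v φ ψ) ρL :=
  h.congr' fun t ht prev u' v φ ψ => by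
    by_cases hR : R t prev u' v φ ψ = 0
    · rw [hR, mul_zero, mul_zero]
    · rw [hχ t ht prev u' v φ ψ hR]

/-- Both at once on the transcribed bracket of (5.9.6): replacing the characteristic-function entry `chars` of a `Bracket596` by another that agrees
with it wherever the remaining factors do not vanish does not change the density. [cite: BalabanImbrieJaffe1988, (5.9.6) p.297] -/
theorem isDT_bracket596_chars (D : Bracket596 P k ι) (chars' : Entry P k ι ℝ)
    (hχ : ∀ t ∈ terms, ∀ prev u' v φ ψ,
      D.holes t prev u' v φ ψ * D.obs t prev u' v φ ψ * (D.zf t prev u' v φ ψ : ℂ) ≠ 0 → chars' t prev u' v φ ψ = D.chars t prev u' v φ ψ)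
    (h : IsDT ν terms Λ Qu (bracket596 D) ρL) :
    IsDT ν terms Λ Qu (bracket596 { D with chars := chars' }) ρL :=
  h.congr' fun t ht prev u' v φ ψ => by
    by_cases hR : D.holes t prev u' v φ ψ * D.obs t prev u' v φ ψ * (D.zf t prev u' v φ ψ : ℂ) = 0
    · simp only [bracket596]
      have h0 : ∀ (x y : ℂ), x * D.holes t prev u' v φ ψ * D.obs t prev u' v φ ψ * (D.zf t prev u' v φ ψ : ℂ) * y = x * y *
          (D.holes t prev u' v φ ψ * D.obs t prev u' v φ ψ * (D.zf t prev u' v φ ψ : ℂ)) := fun x y => by ring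
      rw [h0, h0, hR, mul_zero, mul_zero]
    · simp only [bracket596, exponent596, hχ t ht prev u' v φ ψ hR]

end Insert

end

end Literature.MathematicalPhysics.QuantumFieldTheory.BalabanImbrieJaffe1984to88.BIJ88Eq596Density
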